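import Literature.Probability.LatticeModels.ExplorationWinding
import Summits.CriticalPhenomena.CardyFormulaZ2.Theorems.CardyComplexConeEdgePrecompactShiftStabilityReduction

/-!
# Passage synchronisation of two exploration orbits agreeing inside a ball
(line `qkz-strip-boundary-arm` of crux `CardyComplexCone.EdgePrecompact`, stmt-CriticalPhenomena-11387;
deterministic core of the hull-stability hypothesis of `shiftCouplingLocality_of_hullStability`)

Two completed configurations `β₀`, `β₁` (think: `E.bcBondConfig ω` for a datum and for its lattice
translate, SAME `ω`) drive two orbits `O₀ = cornerOrbit β₀ c₀`, `O₁ = cornerOrbit β₁ c₁` of Smirnov's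
successor map on coded corners (`MedialInterfaceProofs`: the exploration path of admissible data is the
orbit from the start corner cut at the first non-inner face, `explorationList`). Fix a set `I` of
medial vertices (the edges whose midpoint lies in a ball) on which `β₀` and `β₁` AGREE and around which
all faces are inner for both data. An orbit alternates between INTERIOR stretches (corners whose
target edge lies in `I`: the next step reads an edge of `I`, the same for both) and EXTERIOR stretches
(target edge outside `I`). The exterior stretch started at an exit corner `q` (`cSrc q ∈ I`,
`cTgt q ∉ I`) runs deterministically until its first corner with target in `I` (re-entry) — this is
the orbit of `q` itself, so "the two exterior dynamics respond alike from `q`" is the statement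
`Response` below: whenever the `β₀`-orbit of `q` re-enters `I` at step `n` through inner faces, the
`β₁`-orbit of `q` re-enters at the SAME corner, through inner faces, with the SAME accumulated turning
`∑ turnOf`. The initial stretches (from the two start corners) are compared in the same way.

`passageSync`: under these hypotheses every corner of the first orbit (before its exit time `N₀`)
whose source edge lies in `I` is also a corner of the second orbit (before `N₁`), with the same
accumulated turning `∑_{i<k} turnOf` — hence (next file) the two exploration paths traverse every
dart inside the ball alike, with equal windings (`winding_orbitPts`: the winding of the exploration
polyline is the sum of its `±π/2` turns), for EVERY filling of the ball: the event "some filling of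
the ball makes the passages differ" is contained in the purely exterior event "some response differs".
Proof: strong induction along the first orbit; inside a stretch the step reads an edge of `I`
(the successor and the turn read only the target edge), at a re-entry the last exit corner (or the start) is
synchronised by induction and the exterior stretch by `Response`.

References: S. Smirnov, C. R. Acad. Sci. Paris 333 (2001), §2 (the exploration process as a
deterministic turning rule); S. Smirnov, Ann. of Math. 172 (2010), §2.2 (winding = signed number of
`±π/2` turns); G. Grimmett, *Percolation* (1999), §11.2.
-/

namespace Summit.CriticalPhenomena.CardyFormulaZ2.Cruxes.EdgePrecompact.QkzStripBoundaryArm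

open MeasureTheory Filter Set Metric
open scoped Topology BigOperators Pointwise
open Literature.Probability.LatticeModels Literature.Probability.Percolation
open Literature.Probability.RandomPlanarGeometry (DobrushinDomain)
open Summit.CriticalPhenomena.CardyFormulaZ2.Theses.CardyComplexCone

noncomputable section

/-! ## The synchronisation theorem -/

/-- **Passage synchronisation.** Data: two configurations `β₀, β₁`, two inner-face predicates
`In₀, In₁`, a set `I` of medial vertices, two start corners `c₀, c₁` and two exit times `N₀, N₁`
(`Oᵢ = cornerOrbit βᵢ cᵢ`). Hypotheses, in order: `β₀ = β₁` on `I`; corners with an edge in `I` have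
inner faces for both; the start edges are not in `I`; `Nᵢ` is the first time the face of `Oᵢ` is not
inner, and it is positive; INITIAL RESPONSE: if the `β₀`-orbit of `c₀` first enters `I` at step `n`
(targets outside `I` before, inner faces along), the `β₁`-orbit of `c₁` first enters `I` at some step
`n'` through inner faces, at the same corner, with the same turning sum; EXTERIOR RESPONSE: the same
for the two orbits of every exit corner `q` (`cSrc q ∈ I`, `cTgt q ∉ I`). Conclusion: every corner
`O₀ k₀`, `k₀ < N₀`, with source edge in `I` is some `O₁ k₁`, `k₁ < N₁`, with
`∑_{i<k₁} turnOf β₁ (O₁ i) = ∑_{i<k₀} turnOf β₀ (O₀ i)`. (Smirnov 2001, §2; registered sub-goal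
`passageSync` of stmt-CriticalPhenomena-11387.) -/
theorem passageSync : ∀ (β₀ β₁ : BondConfig (Site 2)) (In₀ In₁ : Site 2 → Prop) (I : Set (Sym2 (Site 2))) (c₀ c₁ : Site 2 × Fin 4) (N₀ N₁ : ℕ), (∀ e ∈ I, (e ∈ β₀ ↔ e ∈ β₁)) → (∀ p : Site 2 × Fin 4, (cSrc p ∈ I ∨ cTgt p ∈ I) → In₀ (cFace p) ∧ In₁ (cFace p)) → cSrc c₀ ∉ I → cSrc c₁ ∉ I → ¬ In₀ (cFace (cornerOrbit β₀ c₀ N₀)) → (∀ k < N₀, In₀ (cFace (cornerOrbit β₀ c₀ k))) → 0 < N₀ → ¬ In₁ (cFace (cornerOrbit β₁ c₁ N₁)) → (∀ k < N₁, In₁ (cFace (cornerOrbit β₁ c₁ k))) → 0 < N₁ → (∀ n : ℕ, (∀ i < n, cTgt (cornerOrbit β₀ c₀ i) ∉ I ∧ In₀ (cFace (cornerOrbit β₀ c₀ (i + 1)))) → cTgt (cornerOrbit β₀ c₀ n) ∈ I → ∃ n' : ℕ, (∀ i < n', cTgt (cornerOrbit β₁ c₁ i) ∉ I ∧ In₁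 (cFace (cornerOrbit β₁ c₁ (i + 1)))) ∧ cornerOrbit β₁ c₁ n' = cornerOrbit β₀ c₀ n ∧ ∑ i ∈ Finset.range n', turnOf β₁ (cornerOrbit β₁ c₁ i) = ∑ i ∈ Finset.range n, turnOf β₀ (cornerOrbit β₀ c₀ i)) → (∀ q : Site 2 × Fin 4, cSrc q ∈ I → cTgt q ∉ I → ∀ n : ℕ, (∀ i < n, cTgt (cornerOrbit β₀ q i) ∉ I ∧ In₀ (cFace (cornerOrbit β₀ q (i + 1)))) → cTgt (cornerOrbit β₀ q n) ∈ I → ∃ n' : ℕ, (∀ i < n', cTgt (cornerOrbit β₁ q i) ∉ I ∧ In₁ (cFace (cornerOrbit β₁ q (i + 1)))) ∧ cornerOrbit β₁ q n' = cornerOrbit β₀ q n ∧ ∑ i ∈ Finset.range n', turnOf β₁ (cornerOrbit β₁ q i) = ∑ i ∈ Finset.range n, turnOf β₀ (cornerOrbit β₀ q i)) → ∀ k₀ < N₀, cSrc (cornerOrbit β₀ c₀ k₀) ∈ I → ∃ k₁ < N₁, cornerOrbit β₁ c₁ k₁ = cornerOrbit β₀ c₀ k₀ ∧ ∑ i ∈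 Finset.range k₁, turnOf β₁ (cornerOrbit β₁ c₁ i) = ∑ i ∈ Finset.range k₀, turnOf β₀ (cornerOrbit β₀ c₀ i) := by
  intro β₀ β₁ In₀ In₁ I c₀ c₁ N₀ N₁ hβ hI hc₀ _hc₁ _hN₀ hlt₀ _hpos₀ hN₁ hlt₁ hpos₁ hInit hResp k₀
  -- orbit bookkeeping (the tree's `cornerOrbit_add'`, `cSrc_nextCorner`, `nextCorner_congr`, inlined):
  -- orbits compose, consecutive corners chain, and the successor / the turn read only the target edge
  have cornerOrbit_add : ∀ (β : BondConfig (Site 2)) (c : Site 2 × Fin 4) (a i : ℕ),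
      cornerOrbit β c (a + i) = cornerOrbit β (cornerOrbit β c a) i := by
    intro β c a i
    induction i with
    | zero => rfl
    | succ i ih =>
      show nextCorner β (cornerOrbit β c (a + i)) = nextCorner β (cornerOrbit β (cornerOrbit β c a) i)
      rw [ih]
  have cSrc_cornerOrbit_succ' : ∀ (β : BondConfig (Site 2)) (c : Site 2 × Fin 4) (n : ℕ),
      cSrc (cornerOrbit β c (n + 1)) = cTgt (cornerOrbit β c n) := fun _ _ _ => cSrc_nextCorner _
  have nextCorner_congr' : ∀ {p : Site 2 × Fin 4}, (cTgt p ∈ β₀ ↔ cTgt p ∈ β₁) →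
      nextCorner β₀ p = nextCorner β₁ p := by
    intro p h
    by_cases h₀ : cTgt p ∈ β₀
    · rw [nextCorner_of_mem h₀, nextCorner_of_mem (h.1 h₀)]
    · rw [nextCorner_of_not_mem h₀, nextCorner_of_not_mem fun h₁ => h₀ (h.2 h₁)]
  have turnOf_congr' : ∀ {p : Site 2 × Fin 4}, (cTgt p ∈ β₀ ↔ cTgt p ∈ β₁) →
      turnOf β₀ p = turnOf β₁ p := by
    intro p h
    by_cases h₀ : cTgt p ∈ β₀
    · simp [turnOf, h₀, h.1 h₀]
    · have h₁ : cTgt p ∉ β₁ := fun h₁ => h₀ (h.2 h₁)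
      simp [turnOf, h₀, h₁]
  induction k₀ using Nat.strong_induction_on with
  | _ k₀ ih => ?_
  intro hk₀ hsrc
  -- the start edge is not in `I`, so `k₀ = k + 1`, and the source of `O₀ (k+1)` is the target of `O₀ k`
  obtain ⟨k, rfl⟩ : ∃ k, k₀ = k + 1 := by
    rcases k₀ with _ | k
    · exact absurd hsrc hc₀
    · exact ⟨k, rfl⟩
  rw [cSrc_cornerOrbit_succ'] at hsrc
  have hagree : cTgt (cornerOrbit β₀ c₀ k) ∈ β₀ ↔ cTgt (cornerOrbit β₀ c₀ k) ∈ β₁ := hβ _ hsrc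
  -- a bound on indices of the second orbit: inner faces up to `m` force `m < N₁`
  have hbound : ∀ m : ℕ, (∀ l, 0 < l → l ≤ m → In₁ (cFace (cornerOrbit β₁ c₁ l))) → m < N₁ := by
    intro m hm
    by_contra hcon
    exact hN₁ (hm N₁ hpos₁ (by omega))
  by_cases hA : cSrc (cornerOrbit β₀ c₀ k) ∈ I
  · -- INTERIOR step: the previous corner is synchronised, the step reads the edge `cTgt (O₀ k) ∈ I`
    obtain ⟨k₁, hk₁, hEq, hS⟩ := ih k (Nat.lt_succ_self k) (by omega) hA
    refine ⟨k₁ + 1, ?_, ?_, ?_⟩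
    · refine hbound _ fun l hl hlk => ?_
      rcases Nat.lt_or_ge l (k₁ + 1) with h | h
      · exact hlt₁ l (by omega)
      · obtain rfl : l = k₁ + 1 := by omega
        refine (hI _ (Or.inl ?_)).2
        rw [cSrc_cornerOrbit_succ', hEq]
        exact hsrc
    · show nextCorner β₁ (cornerOrbit β₁ c₁ k₁) = nextCorner β₀ (cornerOrbit β₀ c₀ k)
      rw [hEq]
      exact (nextCorner_congr' hagree).symm
    · rw [Finset.sum_range_succ, Finset.sum_range_succ, hS, hEq, turnOf_congr' hagree]
  · by_cases hB : ∃ j < k, cSrc (cornerOrbit β₀ c₀ j) ∈ I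
    · -- RE-ENTRY after the exterior stretch started at the last exit corner `O₀ j`
      classical
      set j := Nat.findGreatest (fun j => cSrc (cornerOrbit β₀ c₀ j) ∈ I) k with hj_def
      obtain ⟨m, hmk, hm⟩ := hB
      have hjP : cSrc (cornerOrbit β₀ c₀ j) ∈ I :=
        Nat.findGreatest_spec (P := fun j => cSrc (cornerOrbit β₀ c₀ j) ∈ I) hmk.le hm
      have hjk : j ≤ k := Nat.findGreatest_le k
      have hmax : ∀ l, j < l → l ≤ k → cSrc (cornerOrbit β₀ c₀ l) ∉ I := fun l hjl hlk =>
        Nat.findGreatest_is_greatest hjl hlk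
      have hjlt : j < k := lt_of_le_of_ne hjk fun h => hA (h ▸ hjP)
      -- the exit corner `q = O₀ j` and the `β₀`-stretch of length `k - j` from it
      have horb₀ : ∀ i, cornerOrbit β₀ (cornerOrbit β₀ c₀ j) i = cornerOrbit β₀ c₀ (j + i) :=
        fun i => (cornerOrbit_add β₀ c₀ j i).symm
      have hq_tgt : cTgt (cornerOrbit β₀ c₀ j) ∉ I := by
        rw [← cSrc_cornerOrbit_succ']
        exact hmax (j + 1) (Nat.lt_succ_self j) (by omega)
      have hpre : ∀ i < k - j, cTgt (cornerOrbit β₀ (cornerOrbit β₀ c₀ j) i) ∉ I ∧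
          In₀ (cFace (cornerOrbit β₀ (cornerOrbit β₀ c₀ j) (i + 1))) := fun i hi => by
        rw [horb₀, horb₀, ← cSrc_cornerOrbit_succ']
        exact ⟨hmax (j + i + 1) (by omega) (by omega), hlt₀ _ (by omega)⟩
      have hentry : cTgt (cornerOrbit β₀ (cornerOrbit β₀ c₀ j) (k - j)) ∈ I := by
        rw [horb₀, show j + (k - j) = k by omega]
        exact hsrc
      -- synchronise the exit corner by induction, the stretch by the exterior response
      obtain ⟨j₁, hj₁, hEq, hS⟩ := ih j (by omega) (by omega) hjP
      obtain ⟨n₁, hstr₁, hcorner, hsum⟩ := hResp _ hjP hq_tgt (k - j) hpre hentry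
      have horb₁ : ∀ i, cornerOrbit β₁ (cornerOrbit β₀ c₀ j) i = cornerOrbit β₁ c₁ (j₁ + i) :=
        fun i => by rw [← hEq, cornerOrbit_add]
      rw [horb₀, show j + (k - j) = k by omega] at hcorner
      -- hcorner : cornerOrbit β₁ (O₀ j) n₁ = O₀ k
      refine ⟨j₁ + n₁ + 1, ?_, ?_, ?_⟩
      · refine hbound _ fun l hl hlk => ?_
        rcases Nat.lt_or_ge l (j₁ + 1) with h | h
        · exact hlt₁ l (by omega)
        · rcases Nat.lt_or_ge l (j₁ + n₁ + 1) with h' | h'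
          · obtain ⟨i, rfl⟩ : ∃ i, l = j₁ + (i + 1) := ⟨l - j₁ - 1, by omega⟩
            have := (hstr₁ i (by omega)).2
            rwa [horb₁] at this
          · obtain rfl : l = j₁ + n₁ + 1 := by omega
            refine (hI _ (Or.inl ?_)).2
            rw [cSrc_cornerOrbit_succ', show j₁ + n₁ = j₁ + n₁ from rfl, ← horb₁, hcorner]
            exact hsrc
      · show nextCorner β₁ (cornerOrbit β₁ c₁ (j₁ + n₁)) = nextCorner β₀ (cornerOrbit β₀ c₀ k)
        rw [← horb₁, hcorner]
        exact (nextCorner_congr' hagree).symm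
      · have hsum' : ∑ i ∈ Finset.range n₁, turnOf β₁ (cornerOrbit β₁ c₁ (j₁ + i)) =
            ∑ i ∈ Finset.range (k - j), turnOf β₀ (cornerOrbit β₀ c₀ (j + i)) := by
          simpa only [horb₀, horb₁] using hsum
        have hsplit := Finset.sum_range_add (fun i => turnOf β₀ (cornerOrbit β₀ c₀ i)) j (k - j)
        rw [show j + (k - j) = k by omega] at hsplit
        rw [Finset.sum_range_succ, Finset.sum_range_succ, Finset.sum_range_add, hS, hsum', hsplit,
          ← horb₁, hcorner, turnOf_congr' hagree]
    · -- FIRST ENTRY: the initial stretch of `O₀` enters `I` at step `k`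
      have hpre : ∀ i < k, cTgt (cornerOrbit β₀ c₀ i) ∉ I ∧ In₀ (cFace (cornerOrbit β₀ c₀ (i + 1))) :=
        fun i hi => by
          rw [← cSrc_cornerOrbit_succ']
          refine ⟨fun h => ?_, hlt₀ _ (by omega)⟩
          rcases Nat.lt_or_ge (i + 1) k with h' | h'
          · exact hB ⟨i + 1, h', h⟩
          · obtain rfl : i + 1 = k := by omega
            exact hA h
      obtain ⟨n₁, hstr₁, hcorner, hsum⟩ := hInit k hpre hsrc
      refine ⟨n₁ + 1, ?_, ?_, ?_⟩
      · refine hbound _ fun l hl hlk => ?_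
        rcases Nat.lt_or_ge l (n₁ + 1) with h | h
        · obtain ⟨i, rfl⟩ : ∃ i, l = i + 1 := ⟨l - 1, by omega⟩
          exact (hstr₁ i (by omega)).2
        · obtain rfl : l = n₁ + 1 := by omega
          refine (hI _ (Or.inl ?_)).2
          rw [cSrc_cornerOrbit_succ', hcorner]
          exact hsrc
      · show nextCorner β₁ (cornerOrbit β₁ c₁ n₁) = nextCorner β₀ (cornerOrbit β₀ c₀ k)
        rw [hcorner]
        exact (nextCorner_congr' hagree).symm
      · rw [Finset.sum_range_succ, Finset.sum_range_succ, hsum, hcorner, turnOf_congr' hagree]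

end

end Summit.CriticalPhenomena.CardyFormulaZ2.Cruxes.EdgePrecompact.QkzStripBoundaryArm
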